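import Mathlib
import HarnessLib
import Summits.ResolutionOfSingularities.ResolutionOfSingularities.Theorems.WildQuotientsWildQuotientResolutionS1aSymTail
import Summits.ResolutionOfSingularities.ResolutionOfSingularities.Theorems.WildQuotientsWildQuotientResolutionS1aSymMember

/-!
# S1a — THE MEMBER ON A PRODUCER CHART OF THE SYMMETRIC ROOT, read through the pinned root model (one lemma per chart, for the assembly)

[OURS · L1 W4.5c · lead-1 g15; R3 brick 6 = ✓`exists_isPrincipalCentre_of_symMember` (`…S1aSymMember`) specialised to the node of a producer chart of the symmetric
root with its free model ✓`chartRingEquivAway … Ψ` and the rows/degrees of ✓`…S1aSymChartModel`; it keeps the structure literal of the node and the transported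
grading OUT of the assembly of `a1_killsIn_two` / `lines_killsIn_two` (elaboration budget)] — NOT statements of the manuscript; counted 0; AI-level work, weaker than
expert review. Crux stmt-ResolutionOfSingularities-17941 `CyclicQuotientFourfolds`, line `s1a-logminvertex` v13 (`stub_reachLowerInFX`).

* ★★★ `exists_isPrincipalCentre_of_symChart` — data: the symmetric-root datum through `e` (any `δ`, tail `t` with `e⁻¹t ∈ 𝒥_δ`, `subst t = x_none^δ·T′`), a node grading
  `𝒜` on `A` (trivial in practice), a σ-fixed cover element `y`, a model `M` with a stable affine chart `W` carrying the PRODUCER NODE of `y` (`E`, tame, intertwining —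
  as delivered by ✓`exists_moveAtlas_of_node`), a pinned root model `Ψ`, a component VARIABLE `x_{jφ}` (`jφ ∈ {1, 2}` via its row and degree) with `T′ = H·x_{jφ}`
  for a polynomial `H ∣ Ψ(yT^{dbar})` (a unit on the chart) and a point of `V(x₀′, x_{jφ})` off `Ψ(yT^{dbar}) = 0`, a GIVEN Veronese degree, and separating sections
  `u_i` (cover `U_i` of the complement of `W`, values `Φ(E u_i) ∈ 𝒥₁`). Conclusion: a PRINCIPAL centre `J` of that degree, `W` a principal-centre chart, `supp J ⊆ W`,
  `supp J` disjoint from every `U_i`.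
-/

set_option linter.dupNamespace false

noncomputable section

open CategoryTheory Limits AlgebraicGeometry TopologicalSpace Topology Opposite MvPolynomial
open Literature.AlgebraicGeometry.Resolution Literature.AlgebraicGeometry.RelativeSpec
open scoped LaurentPolynomial
open Summit.ResolutionOfSingularities.ResolutionOfSingularities.Theorems.WildQuotientResolution.S1
open Summit.ResolutionOfSingularities.ResolutionOfSingularities.Theorems.WildQuotientResolution.S1.NodeAtlas
open Summit.ResolutionOfSingularities.ResolutionOfSingularities.Theorems.WildQuotientResolution.S1.CoarseChart
open Summit.ResolutionOfSingularities.ResolutionOfSingularities.Theorems.WildQuotientResolution.S1.ProducerStep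
open Summit.ResolutionOfSingularities.ResolutionOfSingularities.Theorems.WildQuotientResolution.S1.NpFrame
open Summit.ResolutionOfSingularities.ResolutionOfSingularities.Theorems.WildQuotientResolution.S1.GoodCharts
open Summit.ResolutionOfSingularities.ResolutionOfSingularities.Theorems.WildQuotientResolution.S1.BlowupCharts
open Summit.ResolutionOfSingularities.ResolutionOfSingularities.Theorems.WildQuotientResolution.S1.KillCert
open Summit.ResolutionOfSingularities.ResolutionOfSingularities.Theorems.WildQuotientResolution.S1.ReesBigrading
open Summit.ResolutionOfSingularities.ResolutionOfSingularities.Theorems.WildQuotientResolution.S1.NodeTransport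
open Summit.ResolutionOfSingularities.ResolutionOfSingularities.Theorems.WildQuotientResolution.S1.CobordantTransport
open Summit.ResolutionOfSingularities.ResolutionOfSingularities.Theorems.WildQuotientResolution.S1.FreeModel

/-! ## Model facts for the norm charts `k[x_none, x′][1/H_j]`, `H_j = (∏ᵢ (X_j′ + i·X₀′x_none^δ))^e` -/

namespace Summit.ResolutionOfSingularities.ResolutionOfSingularities.Theorems.WildQuotientResolution.S1.KillCert.Sym

variable (k : Type) [Field k] {p : ℕ} [NeZero p]

/-- `X_j′` divides the model norm `H_j` (the factor `i = 0`), for `e ≠ 0`. -/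
theorem sym_normModel_dvd (j : Fin 4) (δ e : ℕ) (he : e ≠ 0) :
    (X (some j) : MvPolynomial (Option (Fin 4)) k) ∣
      (∏ i : ZMod p, (X (some j) + (i.val : MvPolynomial (Option (Fin 4)) k) * (X (some 0) * X none ^ δ))) ^ e := by
  refine Dvd.dvd.trans ?_ (dvd_pow_self _ he)
  have h0 : (X (some j) : MvPolynomial (Option (Fin 4)) k) = X (some j) + ((0 : ZMod p).val : MvPolynomial (Option (Fin 4)) k) * (X (some 0) * X none ^ δ) := by
    rw [ZMod.val_zero, Nat.cast_zero, zero_mul, add_zero]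
  conv_lhs => rw [h0]
  exact Finset.dvd_prod_of_mem (fun i : ZMod p => X (some j) + (i.val : MvPolynomial (Option (Fin 4)) k) * (X (some 0) * X none ^ δ)) (Finset.mem_univ _)

/-- The point `x_{j}′ = 1`, all other coordinates `0`, is off `H_j = 0` (`j ≠ 0`). -/
theorem sym_eval_normModel_ne_zero (j : Fin 4) (hj : j ≠ 0) (δ e : ℕ) :
    MvPolynomial.eval (fun o : Option (Fin 4) => if o = some j then (1 : k) else 0)
      ((∏ i : ZMod p, (X (some j) + (i.val : MvPolynomial (Option (Fin 4)) k) * (X (some 0) * X none ^ δ))) ^ e) ≠ 0 := by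
  have hj' : (some 0 : Option (Fin 4)) ≠ some j := fun h => hj (Option.some_injective _ h).symm
  simp [map_prod, MvPolynomial.eval_X, hj']


omit [NeZero p] in
/-- `x₀′ⁿ ∈ 𝒥₁((x₀′ : 2, x_j′ : 1))` in any model (`n > 0`). -/
theorem sym_memberFiltration_pow_mem (L : Type) [CommRing L] [Algebra (MvPolynomial (Option (Fin 4)) k) L] (j : Fin 4) (n : ℕ) (hn : 0 < n) :
    algebraMap (MvPolynomial (Option (Fin 4)) k) L (X (some 0) ^ n) ∈
      (weightedFiltration (fun i => algebraMap (MvPolynomial (Option (Fin 4)) k) L (X ((![some 0, some j] : Fin 2 → Option (Fin 4)) i))) ![2, 1]).ideal 1 := by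
  rw [map_pow]
  refine Ideal.pow_mem_of_mem _ ?_ _ hn
  exact (weightedFiltration _ _).antitone (by norm_num)
    (mem_weightedFiltration_ideal (fun i => algebraMap (MvPolynomial (Option (Fin 4)) k) L (X ((![some 0, some j] : Fin 2 → Option (Fin 4)) i))) ![2, 1] 0)

omit [NeZero p] in
/-- A multiple of `x_j′` lies in `𝒥₁((x₀′ : 2, x_j′ : 1))` in any model. -/
theorem sym_memberFiltration_mem_of_dvd (L : Type) [CommRing L] [Algebra (MvPolynomial (Option (Fin 4)) k) L] (j : Fin 4) (q : MvPolynomial (Option (Fin 4)) k)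
    (hq : (X (some j) : MvPolynomial (Option (Fin 4)) k) ∣ q) :
    algebraMap (MvPolynomial (Option (Fin 4)) k) L q ∈
      (weightedFiltration (fun i => algebraMap (MvPolynomial (Option (Fin 4)) k) L (X ((![some 0, some j] : Fin 2 → Option (Fin 4)) i))) ![2, 1]).ideal 1 :=
  Ideal.mem_of_dvd _ (map_dvd _ hq)
    (mem_weightedFiltration_ideal (fun i => algebraMap (MvPolynomial (Option (Fin 4)) k) L (X ((![some 0, some j] : Fin 2 → Option (Fin 4)) i))) ![2, 1] 1)

end Summit.ResolutionOfSingularities.ResolutionOfSingularities.Theorems.WildQuotientResolution.S1.KillCert.Sym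

namespace Summit.ResolutionOfSingularities.ResolutionOfSingularities.Theorems.WildQuotientResolution.S1.GameFrame.GModel

variable {p : ℕ} {X' X₁ : Scheme.{0}} {q : X' ⟶ X₁} {G : Type} [Group G] {ρ : G →* Aut X'} {g₀ : G}

/-- **A Veronese degree for the member centre `(x₀′ : 2, x_{jφ} : 1)` on a producer chart of the symmetric root** (✓`Veronese.veroneseNormalisation` on the
transported tame node). -/
theorem exists_veroneseNormalised_symChart {k : Type} [Field k] {A : Type} [CommRing A] (δ : ℕ) (e : A ≃+* MvPolynomial (Fin 4) k) (τ : A ≃+* A)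
    (hp : 0 < p) (hσp : ∀ x : A, (⇑τ)^[p] x = x)
    (hσJ : ∀ n : ℕ, ((weightedFiltration (e.symm ∘ ![X 0, X 1, X 2] : Fin 3 → A) ![δ + 1, 1, 1]).ideal n).map (τ : A →+* A) ≤
      (weightedFiltration (e.symm ∘ ![X 0, X 1, X 2] : Fin 3 → A) ![δ + 1, 1, 1]).ideal n)
    {m : ℕ} (mo : Fin m → ℕ) (𝒜 : (Π j : Fin m, ZMod (mo j)) → AddSubgroup A) [GradedRing 𝒜]
    (hf : ∀ i, (e.symm ∘ ![X 0, X 1, X 2] : Fin 3 → A) i ∈ 𝒜 ((fun _ => (0 : Π j : Fin m, ZMod (mo j))) i))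
    {dbar : ℕ} (y : ↥(𝒜 0)) (hy : y ∈ (traceFiltration 𝒜 (e.symm ∘ ![X 0, X 1, X 2] : Fin 3 → A) ![δ + 1, 1, 1]).ideal dbar) (hσy : τ (y : A) = y)
    (Ψ : ↥(cobordantAlgebra (e.symm ∘ ![X 0, X 1, X 2] : Fin 3 → A) ![δ + 1, 1, 1]) ≃+* MvPolynomial (Option (Fin 4)) k)
    (hΨ0 : Ψ (cobordantAlgebra.u' (e.symm ∘ ![X 0, X 1, X 2] : Fin 3 → A) ![δ + 1, 1, 1] 0) = X (some 0))
    (htame : letI := chartNodeGradedRing mo 𝒜 (e.symm ∘ ![X 0, X 1, X 2] : Fin 3 → A) ![δ + 1, 1, 1] hf dbar y hy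
      IsTameNode p (ChartRing 𝒜 (e.symm ∘ ![X 0, X 1, X 2] : Fin 3 → A) ![δ + 1, 1, 1] dbar y hy)
        (chartNodeGrading mo 𝒜 (e.symm ∘ ![X 0, X 1, X 2] : Fin 3 → A) ![δ + 1, 1, 1] hf dbar y hy)
        (sigmaChart 𝒜 (e.symm ∘ ![X 0, X 1, X 2] : Fin 3 → A) ![δ + 1, 1, 1] dbar y hy τ hσJ hp hσp hσy))
    (jφ : Fin 4)
    (hφd : letI := chartNodeGradedRing mo 𝒜 (e.symm ∘ ![X 0, X 1, X 2] : Fin 3 → A) ![δ + 1, 1, 1] hf dbar y hy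
      algebraMap (MvPolynomial (Option (Fin 4)) k) (Localization.Away (Ψ (coverElement 𝒜 _ _ dbar y hy))) (X (some jφ)) ∈
        mapGrading (chartNodeGrading mo 𝒜 (e.symm ∘ ![X 0, X 1, X 2] : Fin 3 → A) ![δ + 1, 1, 1] hf dbar y hy) (chartRingEquivAway 𝒜 _ _ dbar y hy Ψ)
          (consIndexEquiv mo ((1 : ℤ), (0 : Π j : Fin m, ZMod (mo j))))) :
    letI := chartNodeGradedRing mo 𝒜 (e.symm ∘ ![X 0, X 1, X 2] : Fin 3 → A) ![δ + 1, 1, 1] hf dbar y hy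
    letI := mapGradedRing (chartNodeGrading mo 𝒜 (e.symm ∘ ![X 0, X 1, X 2] : Fin 3 → A) ![δ + 1, 1, 1] hf dbar y hy) (chartRingEquivAway 𝒜 _ _ dbar y hy Ψ)
    ∃ d : ℕ, VeroneseNormalised (mapGrading (chartNodeGrading mo 𝒜 (e.symm ∘ ![X 0, X 1, X 2] : Fin 3 → A) ![δ + 1, 1, 1] hf dbar y hy) (chartRingEquivAway 𝒜 _ _ dbar y hy Ψ))
        (fun i => algebraMap (MvPolynomial (Option (Fin 4)) k) (Localization.Away (Ψ (coverElement 𝒜 _ _ dbar y hy))) (X ((![some 0, some jφ] : Fin 2 → Option (Fin 4)) i)))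
        ![2, 1] d := by
  letI instN := chartNodeGradedRing mo 𝒜 (e.symm ∘ ![X 0, X 1, X 2] : Fin 3 → A) ![δ + 1, 1, 1] hf dbar y hy
  letI instP := mapGradedRing (chartNodeGrading mo 𝒜 (e.symm ∘ ![X 0, X 1, X 2] : Fin 3 → A) ![δ + 1, 1, 1] hf dbar y hy) (chartRingEquivAway 𝒜 _ _ dbar y hy Ψ)
  have htameT := isTameNode_map (chartNodeGrading mo 𝒜 (e.symm ∘ ![X 0, X 1, X 2] : Fin 3 → A) ![δ + 1, 1, 1] hf dbar y hy)
    (chartRingEquivAway 𝒜 _ _ dbar y hy Ψ) p _ htame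
  exact Veronese.veroneseNormalisation _ _ _ htameT.2.2.2.1 2 _
    ![(δ + 1) • consIndexEquiv mo ((1 : ℤ), (0 : Π j : Fin m, ZMod (mo j))), consIndexEquiv mo ((1 : ℤ), (0 : Π j : Fin m, ZMod (mo j)))] ![2, 1]
    (fun i => by fin_cases i; exacts [Sym.sym_model_degree_zero δ e Ψ hΨ0 mo 𝒜 hf y hy, hφd])

set_option maxHeartbeats 8000000 in
set_option synthInstance.maxHeartbeats 400000 in
/-- ★★★ **THE MEMBER ON A PRODUCER CHART OF THE SYMMETRIC ROOT.** See the module docstring. [OURS · L1 W4.5c · R3 member per chart; NOT a statement of the manuscript] -/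
theorem exists_isPrincipalCentre_of_symChart [Finite G] (hG : ∀ g : G, g ∈ Subgroup.zpowers g₀)
    {k : Type} [Field k] {A : Type} [CommRing A]
    (σ : MvPolynomial (Fin 4) k ≃+* MvPolynomial (Fin 4) k) (hC : ∀ a : k, σ (C a) = C a)
    (h0 : σ (X 0) = X 0) (h1 : σ (X 1) = X 1 + X 0) (h2 : σ (X 2) = X 2 + X 0) (δ : ℕ) (t : MvPolynomial (Fin 4) k)
    (h3 : σ (X 3) = X 3 + t) (e : A ≃+* MvPolynomial (Fin 4) k) (τ : A ≃+* A) (hact : ∀ x : A, τ x = e.symm (σ (e x)))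
    (ht : e.symm t ∈ (weightedFiltration (e.symm ∘ ![X 0, X 1, X 2] : Fin 3 → A) ![δ + 1, 1, 1]).ideal δ)
    (hp : 0 < p) (hσp : ∀ x : A, (⇑τ)^[p] x = x)
    (hσJ : ∀ n : ℕ, ((weightedFiltration (e.symm ∘ ![X 0, X 1, X 2] : Fin 3 → A) ![δ + 1, 1, 1]).ideal n).map (τ : A →+* A) ≤
      (weightedFiltration (e.symm ∘ ![X 0, X 1, X 2] : Fin 3 → A) ![δ + 1, 1, 1]).ideal n)
    {m : ℕ} (mo : Fin m → ℕ) (𝒜 : (Π j : Fin m, ZMod (mo j)) → AddSubgroup A) [GradedRing 𝒜]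
    (hf : ∀ i, (e.symm ∘ ![X 0, X 1, X 2] : Fin 3 → A) i ∈ 𝒜 ((fun _ => (0 : Π j : Fin m, ZMod (mo j))) i))
    {dbar : ℕ} (y : ↥(𝒜 0)) (hy : y ∈ (traceFiltration 𝒜 (e.symm ∘ ![X 0, X 1, X 2] : Fin 3 → A) ![δ + 1, 1, 1]).ideal dbar) (hσy : τ (y : A) = y)
    -- the pinned root model and the tail
    (Ψ : ↥(cobordantAlgebra (e.symm ∘ ![X 0, X 1, X 2] : Fin 3 → A) ![δ + 1, 1, 1]) ≃+* MvPolynomial (Option (Fin 4)) k)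
    (hΨa : ∀ a : MvPolynomial (Fin 4) k, Ψ (algebraMap A _ (e.symm a)) = cobordantAlgebra.subst k (![δ + 1, 1, 1, 0] : Fin 4 → ℕ) a)
    (hΨs : Ψ (cobordantAlgebra.s _ _) = X none)
    (hΨ0 : Ψ (cobordantAlgebra.u' (e.symm ∘ ![X 0, X 1, X 2] : Fin 3 → A) ![δ + 1, 1, 1] 0) = X (some 0))
    (hΨ1 : Ψ (cobordantAlgebra.u' (e.symm ∘ ![X 0, X 1, X 2] : Fin 3 → A) ![δ + 1, 1, 1] 1) = X (some 1))
    (hΨ2 : Ψ (cobordantAlgebra.u' (e.symm ∘ ![X 0, X 1, X 2] : Fin 3 → A) ![δ + 1, 1, 1] 2) = X (some 2))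
    (T' : MvPolynomial (Option (Fin 4)) k) (hT' : cobordantAlgebra.subst k (![δ + 1, 1, 1, 0] : Fin 4 → ℕ) t = X none ^ δ * T')
    -- the chart and its producer node
    (M : GModel p q G ρ g₀) [M.V.IsSeparated] (W : M.act.StableAffineOpens) (hW : IsAffineOpen W.1)
    (E : letI := chartNodeGradedRing mo 𝒜 (e.symm ∘ ![X 0, X 1, X 2] : Fin 3 → A) ![δ + 1, 1, 1] hf dbar y hy
      Γ(M.V, W.1) ≃+* ↥(chartNodeGrading mo 𝒜 (e.symm ∘ ![X 0, X 1, X 2] : Fin 3 → A) ![δ + 1, 1, 1] hf dbar y hy 0))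
    (htame : letI := chartNodeGradedRing mo 𝒜 (e.symm ∘ ![X 0, X 1, X 2] : Fin 3 → A) ![δ + 1, 1, 1] hf dbar y hy
      IsTameNode p (ChartRing 𝒜 (e.symm ∘ ![X 0, X 1, X 2] : Fin 3 → A) ![δ + 1, 1, 1] dbar y hy)
        (chartNodeGrading mo 𝒜 (e.symm ∘ ![X 0, X 1, X 2] : Fin 3 → A) ![δ + 1, 1, 1] hf dbar y hy)
        (sigmaChart 𝒜 (e.symm ∘ ![X 0, X 1, X 2] : Fin 3 → A) ![δ + 1, 1, 1] dbar y hy τ hσJ hp hσp hσy))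
    (hE : letI := chartNodeGradedRing mo 𝒜 (e.symm ∘ ![X 0, X 1, X 2] : Fin 3 → A) ![δ + 1, 1, 1] hf dbar y hy
      ∀ t' : Γ(M.V, W.1), ((E ((M.act.aut g₀⁻¹).hom.appLE W.1 W.1 (W.2.1 g₀⁻¹).ge t') :
          ↥(chartNodeGrading mo 𝒜 (e.symm ∘ ![X 0, X 1, X 2] : Fin 3 → A) ![δ + 1, 1, 1] hf dbar y hy 0)) :
            ChartRing 𝒜 (e.symm ∘ ![X 0, X 1, X 2] : Fin 3 → A) ![δ + 1, 1, 1] dbar y hy) =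
        sigmaChart 𝒜 (e.symm ∘ ![X 0, X 1, X 2] : Fin 3 → A) ![δ + 1, 1, 1] dbar y hy τ hσJ hp hσp hσy
          ((E t' : ↥(chartNodeGrading mo 𝒜 (e.symm ∘ ![X 0, X 1, X 2] : Fin 3 → A) ![δ + 1, 1, 1] hf dbar y hy 0)) :
            ChartRing 𝒜 (e.symm ∘ ![X 0, X 1, X 2] : Fin 3 → A) ![δ + 1, 1, 1] dbar y hy))
    -- the component variable `x_{jφ}`, the unit `H`, a point, the Veronese degree
    (jφ : Fin 4) (hjφ : (some 0 : Option (Fin 4)) ≠ some jφ)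
    (hφrow : conj (chartRingEquivAway 𝒜 _ _ dbar y hy Ψ) (sigmaChart 𝒜 _ _ dbar y hy τ hσJ hp hσp hσy)
        (algebraMap (MvPolynomial (Option (Fin 4)) k) (Localization.Away (Ψ (coverElement 𝒜 _ _ dbar y hy))) (X (some jφ))) =
      algebraMap (MvPolynomial (Option (Fin 4)) k) (Localization.Away (Ψ (coverElement 𝒜 _ _ dbar y hy))) (X (some jφ)) +
        algebraMap (MvPolynomial (Option (Fin 4)) k) (Localization.Away (Ψ (coverElement 𝒜 _ _ dbar y hy))) (X none) ^ δ *
          algebraMap (MvPolynomial (Option (Fin 4)) k) (Localization.Away (Ψ (coverElement 𝒜 _ _ dbar y hy))) (X (some 0)))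
    (hφd : letI := chartNodeGradedRing mo 𝒜 (e.symm ∘ ![X 0, X 1, X 2] : Fin 3 → A) ![δ + 1, 1, 1] hf dbar y hy
      algebraMap (MvPolynomial (Option (Fin 4)) k) (Localization.Away (Ψ (coverElement 𝒜 _ _ dbar y hy))) (X (some jφ)) ∈
        mapGrading (chartNodeGrading mo 𝒜 (e.symm ∘ ![X 0, X 1, X 2] : Fin 3 → A) ![δ + 1, 1, 1] hf dbar y hy) (chartRingEquivAway 𝒜 _ _ dbar y hy Ψ)
          (consIndexEquiv mo ((1 : ℤ), (0 : Π j : Fin m, ZMod (mo j)))))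
    (H : MvPolynomial (Option (Fin 4)) k) (hXR : T' = H * X (some jφ)) (hdvd : H ∣ Ψ (coverElement 𝒜 _ _ dbar y hy))
    (g : Option (Fin 4) → k) (hg0 : g (some 0) = 0) (hgφ : g (some jφ) = 0) (hu : MvPolynomial.eval g (Ψ (coverElement 𝒜 _ _ dbar y hy)) ≠ 0)
    (d : ℕ) (l : ℕ) (hl : 0 < l)
    (hver : letI := chartNodeGradedRing mo 𝒜 (e.symm ∘ ![X 0, X 1, X 2] : Fin 3 → A) ![δ + 1, 1, 1] hf dbar y hy
      letI := mapGradedRing (chartNodeGrading mo 𝒜 (e.symm ∘ ![X 0, X 1, X 2] : Fin 3 → A) ![δ + 1, 1, 1] hf dbar y hy) (chartRingEquivAway 𝒜 _ _ dbar y hy Ψ)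
      VeroneseNormalised (mapGrading (chartNodeGrading mo 𝒜 (e.symm ∘ ![X 0, X 1, X 2] : Fin 3 → A) ![δ + 1, 1, 1] hf dbar y hy) (chartRingEquivAway 𝒜 _ _ dbar y hy Ψ))
        (fun i => algebraMap (MvPolynomial (Option (Fin 4)) k) (Localization.Away (Ψ (coverElement 𝒜 _ _ dbar y hy))) (X ((![some 0, some jφ] : Fin 2 → Option (Fin 4)) i)))
        ![2, 1] d)
    -- separating sections
    {κ : Type} (U : κ → M.V.Opens) (hcov : ∀ x : M.V, x ∈ W.1 ∨ ∃ i, x ∈ U i) (u : κ → Γ(M.V, W.1))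
    (v : κ → ↥(cobordantAlgebra (e.symm ∘ ![X 0, X 1, X 2] : Fin 3 → A) ![δ + 1, 1, 1]))
    (huv : letI := chartNodeGradedRing mo 𝒜 (e.symm ∘ ![X 0, X 1, X 2] : Fin 3 → A) ![δ + 1, 1, 1] hf dbar y hy
      ∀ i, ((E (u i) : ↥(chartNodeGrading mo 𝒜 (e.symm ∘ ![X 0, X 1, X 2] : Fin 3 → A) ![δ + 1, 1, 1] hf dbar y hy 0)) :
          ChartRing 𝒜 (e.symm ∘ ![X 0, X 1, X 2] : Fin 3 → A) ![δ + 1, 1, 1] dbar y hy) =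
        algebraMap _ (ChartRing 𝒜 (e.symm ∘ ![X 0, X 1, X 2] : Fin 3 → A) ![δ + 1, 1, 1] dbar y hy) (v i) * IsLocalization.Away.invSelf (coverElement 𝒜 _ _ dbar y hy))
    (hΨv : ∀ i, (X (some 0) : MvPolynomial (Option (Fin 4)) k) ∣ Ψ (v i) ∨ (X (some jφ) : MvPolynomial (Option (Fin 4)) k) ∣ Ψ (v i))
    (huU : ∀ i, ∀ x ∈ W.1, x ∈ U i → x ∈ M.V.basicOpen (u i)) :
    ∃ J : ReesFiltration M.V, IsPrincipalCentre p M.act g₀ J (d * l) ∧ IsPrincipalCentreChart p M.act g₀ J (d * l) W ∧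
      (((J.ideal (d * l)).support : Set M.V)) ⊆ (W.1 : Set M.V) ∧ ∀ i, Disjoint ((U i : Set M.V)) (((J.ideal (d * l)).support : Set M.V)) := by
  letI instN := chartNodeGradedRing mo 𝒜 (e.symm ∘ ![X 0, X 1, X 2] : Fin 3 → A) ![δ + 1, 1, 1] hf dbar y hy
  letI instP := mapGradedRing (chartNodeGrading mo 𝒜 (e.symm ∘ ![X 0, X 1, X 2] : Fin 3 → A) ![δ + 1, 1, 1] hf dbar y hy) (chartRingEquivAway 𝒜 _ _ dbar y hy Ψ)
  have hver' := CoarseChart.veroneseNormalised_mul _ _ _ hver hl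
  -- rows of `τ′ = conj Φ σ_chart` in the free model
  have rn := Sym.sym_model_row_none δ e τ hp hσp hσJ Ψ hΨs mo 𝒜 y hy hσy
  have r0 := Sym.sym_model_row_zero σ h0 δ e τ hact hp hσp hσJ Ψ hΨ0 mo 𝒜 y hy hσy
  have r1 := Sym.sym_model_row_one σ h1 δ e τ hact hp hσp hσJ Ψ hΨs hΨ0 hΨ1 mo 𝒜 y hy hσy
  have r2 := Sym.sym_model_row_two σ h2 δ e τ hact hp hσp hσJ Ψ hΨs hΨ0 hΨ2 mo 𝒜 y hy hσy
  have r3 := Sym.symT_model_row_three σ δ t h3 e τ hact ht hp hσp hσJ Ψ hΨa hΨs mo 𝒜 y hy hσy T' hT'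
  have rfix := Sym.sym_model_fixed σ hC δ e τ hact hp hσp hσJ Ψ hΨa mo 𝒜 y hy hσy
  have dg0 := Sym.sym_model_degree_zero δ e Ψ hΨ0 mo 𝒜 hf y hy
  have huJ : ∀ i, chartRingEquivAway 𝒜 _ _ dbar y hy Ψ ((E (u i) : ↥(chartNodeGrading mo 𝒜 (e.symm ∘ ![X 0, X 1, X 2] : Fin 3 → A) ![δ + 1, 1, 1] hf dbar y hy 0)) :
        ChartRing 𝒜 (e.symm ∘ ![X 0, X 1, X 2] : Fin 3 → A) ![δ + 1, 1, 1] dbar y hy) ∈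
      (weightedFiltration (fun i => algebraMap (MvPolynomial (Option (Fin 4)) k) (Localization.Away (Ψ (coverElement 𝒜 _ _ dbar y hy)))
        (X ((![some 0, some jφ] : Fin 2 → Option (Fin 4)) i))) ![2, 1]).ideal 1 := by
    intro i
    rw [huv i, chartRingEquivAway_algebraMap_mul_invSelf]
    refine Ideal.mul_mem_right _ _ ?_
    rcases hΨv i with h | h
    · exact Ideal.mem_of_dvd _ (map_dvd _ h) ((weightedFiltration _ _).antitone (by norm_num)
        (mem_weightedFiltration_ideal (fun i => algebraMap (MvPolynomial (Option (Fin 4)) k) (Localization.Away (Ψ (coverElement 𝒜 _ _ dbar y hy)))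
          (X ((![some 0, some jφ] : Fin 2 → Option (Fin 4)) i))) ![2, 1] 0))
    · exact Sym.sym_memberFiltration_mem_of_dvd k _ jφ _ h
  have hXR' : algebraMap (MvPolynomial (Option (Fin 4)) k) (Localization.Away (Ψ (coverElement 𝒜 _ _ dbar y hy))) T' =
      algebraMap (MvPolynomial (Option (Fin 4)) k) (Localization.Away (Ψ (coverElement 𝒜 _ _ dbar y hy))) H *
        algebraMap (MvPolynomial (Option (Fin 4)) k) (Localization.Away (Ψ (coverElement 𝒜 _ _ dbar y hy))) (X (some jφ)) := by
    rw [← map_mul, hXR]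
  exact exists_isPrincipalCentre_of_symMember hG M W
    ({ affine := hW, m := m + 1, r := Fin.cons 0 mo, B := ChartRing 𝒜 (e.symm ∘ ![X 0, X 1, X 2] : Fin 3 → A) ![δ + 1, 1, 1] dbar y hy,
       𝒜 := chartNodeGrading mo 𝒜 (e.symm ∘ ![X 0, X 1, X 2] : Fin 3 → A) ![δ + 1, 1, 1] hf dbar y hy,
       σ := sigmaChart 𝒜 (e.symm ∘ ![X 0, X 1, X 2] : Fin 3 → A) ![δ + 1, 1, 1] dbar y hy τ hσJ hp hσp hσy,
       e := E, tame := htame, intertwine := hE } : NodeData p M.act g₀ W)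
    (Ψ (coverElement 𝒜 _ _ dbar y hy)) (chartRingEquivAway 𝒜 _ _ dbar y hy Ψ)
    (conj (chartRingEquivAway 𝒜 _ _ dbar y hy Ψ) (sigmaChart 𝒜 _ _ dbar y hy τ hσJ hp hσp hσy)) (fun _ => rfl)
    (some 0) (some jφ) hjφ
    (algebraMap (MvPolynomial (Option (Fin 4)) k) (Localization.Away (Ψ (coverElement 𝒜 _ _ dbar y hy))) (X none))
    (algebraMap (MvPolynomial (Option (Fin 4)) k) (Localization.Away (Ψ (coverElement 𝒜 _ _ dbar y hy))) (X (some 1)))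
    (algebraMap (MvPolynomial (Option (Fin 4)) k) (Localization.Away (Ψ (coverElement 𝒜 _ _ dbar y hy))) (X (some 2)))
    (algebraMap (MvPolynomial (Option (Fin 4)) k) (Localization.Away (Ψ (coverElement 𝒜 _ _ dbar y hy))) (X (some 3)))
    (algebraMap (MvPolynomial (Option (Fin 4)) k) (Localization.Away (Ψ (coverElement 𝒜 _ _ dbar y hy))) T')
    (algebraMap (MvPolynomial (Option (Fin 4)) k) (Localization.Away (Ψ (coverElement 𝒜 _ _ dbar y hy))) H)
    (1 : k) (1 : k) (1 : k) δ _ rn r0 (by rw [map_one, one_mul]; exact r1) (by rw [map_one, one_mul]; exact r2) r3 (by rw [map_one, one_mul]; exact hφrow) one_ne_zero hXR'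
    (IsLocalization.Away.isUnit_of_dvd _ hdvd) rfix (A1.a1_model_closure_eq_top _) _ _ dg0 hφd g hg0 hgφ hu (d * l) (Nat.mul_pos hver.1 hl) hver' U hcov u (fun _ => 1)
    (fun _ => one_pos) huJ huU

end Summit.ResolutionOfSingularities.ResolutionOfSingularities.Theorems.WildQuotientResolution.S1.GameFrame.GModel

end
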